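import Mathlib

/-!
# `ChargedEnergyGap` — TWIN RIGIDITY: the two-system rigidity lemma and the wedge-crossing corollary of the {111} dihedral pair
# (cell `decomp-a2c`, lens 3, generation 57, node «TwinTree», part P-E(2/2); SUPPORT beneath (N𝄪) of part P-D `…Theorems.ChargedEnergyGapLocalTransfer`;
# companion P-E(1/2) `…Theorems.ChargedEnergyGapTwinTree` — the Σ3ⁿ edge lemma and tree theorem; the two files are independent)

WHAT THIS TYPES (memo g56 §2.2–2.3, critic row 1075 (iv): «the (L1) table and (L2) lemmas accepted as (N𝄪)'s proof architecture»).
By the edge lemma (companion file) coherent faces and stacking seams inside gross-free weighted matter are COMPLETE planes, and two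
complete non-parallel {111} plane defects meet (dihedral `70.53° / 109.47°`, `cos = ±1/3`) in a junction line that is GROSS (census ask
GROSS-56), so the far weight vanishes within `ϱ/2 = 80` of it.  The metric consequences (N𝄪)'s bookkeeping uses are typed here over an
arbitrary real inner-product space — no lattice, no datum, no dial; the record `(ϱχ, Cχ) = (80, 10⁻⁵)` and the residual of record
(χCOST-56 / GROSS-56) are unchanged.
 * (G) Two planes through a point of their junction line, unit normals `u, v`, `⟪u,v⟫ = c`, `c² = 1/9`; offsets `α = ⟪u,y⟫`,
   `β = ⟪v,y⟫`; FOOT POINT `footPoint` on the line (`inner_left_footPoint`, `inner_right_footPoint`) with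
   `(1 − c²)‖y − ℓ‖² = α² + β² − 2cαβ` (`norm_sub_footPoint_sq`) and `‖y − ℓ‖ ≤ ‖y‖` (`norm_sub_footPoint_le`).
   ★ RIGIDITY `two_system_rigidity(_abs)`: junction line `≥ R` away ⇒ `α² + β² − 2cαβ ≥ (8/9)R²`; the adversary's best case (acute
   wedge) `a² + b² + (2/3)ab ≥ (8/9)R²` with `a = |α|, b = |β|`, i.e. `√(a² + b² + 2ab/3) ≥ (2√2/3)·R` (`= 75.4` at `R = 80`); record
   numerics at `R = ϱχ = 80`: not both `a, b ≤ 46` (`record_rigidity_not_both_le`; symmetric threshold `80/√3 = 46.19`),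
   `a ≤ 3 ⇒ b ≥ 74` (`record_rigidity_far_of_near`; sharp value `74.4`).
 * (W) ★★ WEDGE CROSSING `wedge_crossing_form` (algebra; SOS certificate in its docstring) / `wedge_crossing` (geometry): two points on
   opposite sides of BOTH planes, each `≥ R` from the junction line, are `≥ (2/√3)R` apart (`‖y₁ − y₂‖² ≥ (4/3)R²`); at `R = 80`:
   `≥ 92 = ϱχ + 12` (`record_wedge_crossing_92`; exact `160/√3 = 92.38`; cf. `record_proximity : (80+12)² ≤ 160²/3` of P-D).
HOW (N𝄪)'S PROOF CONSUMES IT (memo g57 §2).  (G) prices the corner / junction neighbourhoods: a site whose offsets from two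
non-parallel complete faces are both small lies within `80` of their gross junction line, where `w = 0` (the `46 / 74` numerals of memo
g56 §2.2); (W) is the proximity lemma behind the window `ϱχ ≤ 89`: a segment of length `< 92` between weighted sites crosses only
mutually parallel faces, so the alive radius `ϱχ + 3` of one instance never reaches tree-distance-2 matter (`ϱχ + 3 + 9 ≤ 92`).

TAGS.  (G), (W): SUPPORT, PROVED (0 sorry; no `def … : Prop`, no instance, no axiom; axioms of `wedge_crossing` = {propext,
Classical.choice, Quot.sound}), beneath (N𝄪) `LocalSeamReductionW` [WEAKER than (Nˢ); UNDECIDED·ATTACKABLE-L].  PRIOR ART: elementary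
Euclidean geometry of the {111} dihedral pair (classical); new is only the typing with the lineage's record numerals.
-/

namespace Summit.AtomisticToContinuum.Crystallization.Theorems.ChargedEnergyGapChartDial


section Rigidity

open scoped InnerProductSpace

variable {V : Type*} [NormedAddCommGroup V] [InnerProductSpace ℝ V]

/-- The FOOT of `y` on the junction line `u^⊥ ∩ v^⊥` of two planes through the origin with unit normals `u, v`,
`⟪u,v⟫ = c`, `c² ≠ 1`: `ℓ = y − λu − μv` with `λ = (α − cβ)/(1 − c²)`, `μ = (β − cα)/(1 − c²)`, `α = ⟪u,y⟫`, `β = ⟪v,y⟫`. -/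
noncomputable def footPoint (u v y : V) (c : ℝ) : V :=
  y - ((⟪u, y⟫_ℝ - c * ⟪v, y⟫_ℝ) / (1 - c ^ 2)) • u - ((⟪v, y⟫_ℝ - c * ⟪u, y⟫_ℝ) / (1 - c ^ 2)) • v

/-- The foot lies on the first plane … -/
theorem inner_left_footPoint (u v y : V) (hu : ‖u‖ = 1) {c : ℝ} (hc : ⟪u, v⟫_ℝ = c) (hc1 : c ^ 2 ≠ 1) :
    ⟪u, footPoint u v y c⟫_ℝ = 0 := by
  have huu : ⟪u, u⟫_ℝ = 1 := by rw [real_inner_self_eq_norm_sq, hu, one_pow]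
  have hD : (1 - c ^ 2) ≠ 0 := sub_ne_zero.2 (Ne.symm hc1)
  simp only [footPoint, inner_sub_right, real_inner_smul_right, huu, hc]
  field_simp
  ring

/-- … and on the second plane, i.e. on the junction line. -/
theorem inner_right_footPoint (u v y : V) (hv : ‖v‖ = 1) {c : ℝ} (hc : ⟪u, v⟫_ℝ = c) (hc1 : c ^ 2 ≠ 1) :
    ⟪v, footPoint u v y c⟫_ℝ = 0 := by
  have hvv : ⟪v, v⟫_ℝ = 1 := by rw [real_inner_self_eq_norm_sq, hv, one_pow]
  have hvu : ⟪v, u⟫_ℝ = c := by rw [real_inner_comm]; exact hc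
  have hD : (1 - c ^ 2) ≠ 0 := sub_ne_zero.2 (Ne.symm hc1)
  simp only [footPoint, inner_sub_right, real_inner_smul_right, hvv, hvu]
  field_simp
  ring

/-- DISTANCE TO THE JUNCTION LINE in plane offsets: `(1 − c²)·‖y − ℓ‖² = α² + β² − 2cαβ`. -/
theorem norm_sub_footPoint_sq (u v y : V) (hu : ‖u‖ = 1) (hv : ‖v‖ = 1) {c : ℝ} (hc : ⟪u, v⟫_ℝ = c)
    (hc1 : c ^ 2 ≠ 1) :
    (1 - c ^ 2) * ‖y - footPoint u v y c‖ ^ 2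
      = ⟪u, y⟫_ℝ ^ 2 + ⟪v, y⟫_ℝ ^ 2 - 2 * c * ⟪u, y⟫_ℝ * ⟪v, y⟫_ℝ := by
  have huu : ⟪u, u⟫_ℝ = 1 := by rw [real_inner_self_eq_norm_sq, hu, one_pow]
  have hvv : ⟪v, v⟫_ℝ = 1 := by rw [real_inner_self_eq_norm_sq, hv, one_pow]
  have hvu : ⟪v, u⟫_ℝ = c := by rw [real_inner_comm]; exact hc
  have hD : (1 - c ^ 2) ≠ 0 := sub_ne_zero.2 (Ne.symm hc1)
  have hy : y - footPoint u v y c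
      = ((⟪u, y⟫_ℝ - c * ⟪v, y⟫_ℝ) / (1 - c ^ 2)) • u + ((⟪v, y⟫_ℝ - c * ⟪u, y⟫_ℝ) / (1 - c ^ 2)) • v := by
    simp only [footPoint]
    abel
  rw [hy, ← real_inner_self_eq_norm_sq]
  simp only [inner_add_left, inner_add_right, real_inner_smul_left, real_inner_smul_right, huu, hvv, hc, hvu]
  field_simp
  ring

/-- The foot is the nearest point of the affine plane `y + span(u,v)` to the origin side: `‖y − ℓ‖ ≤ ‖y‖`
(Pythagoras, `y − ℓ ⊥ ℓ`). -/
theorem norm_sub_footPoint_le (u v y : V) (hu : ‖u‖ = 1) (hv : ‖v‖ = 1) {c : ℝ} (hc : ⟪u, v⟫_ℝ = c)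
    (hc1 : c ^ 2 ≠ 1) : ‖y - footPoint u v y c‖ ^ 2 ≤ ‖y‖ ^ 2 := by
  have h0u := inner_left_footPoint u v y hu hc hc1
  have h0v := inner_right_footPoint u v y hv hc hc1
  have hy : y - footPoint u v y c
      = ((⟪u, y⟫_ℝ - c * ⟪v, y⟫_ℝ) / (1 - c ^ 2)) • u + ((⟪v, y⟫_ℝ - c * ⟪u, y⟫_ℝ) / (1 - c ^ 2)) • v := by
    simp only [footPoint]
    abel
  have horth : ⟪y - footPoint u v y c, footPoint u v y c⟫_ℝ = 0 := by
    rw [hy, inner_add_left, real_inner_smul_left, real_inner_smul_left, h0u, h0v, mul_zero, mul_zero, add_zero]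
  calc ‖y - footPoint u v y c‖ ^ 2
      ≤ ‖y - footPoint u v y c‖ ^ 2 + 2 * ⟪y - footPoint u v y c, footPoint u v y c⟫_ℝ
          + ‖footPoint u v y c‖ ^ 2 := by rw [horth]; nlinarith [norm_nonneg (footPoint u v y c)]
    _ = ‖(y - footPoint u v y c) + footPoint u v y c‖ ^ 2 := (norm_add_sq_real _ _).symm
    _ = ‖y‖ ^ 2 := by rw [sub_add_cancel]

/-- ★ TWO-SYSTEM RIGIDITY (g56 MEMO §2.2, typed). Two planes with unit normals `u, v` at the `{111}` dihedral angle
(`⟪u,v⟫ = c`, `c² = 1/9`: `70.53°` or `109.47°`); if every point of their junction line is at distance `≥ R` from `y`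
then the plane offsets `α = ⟪u,y⟫, β = ⟪v,y⟫` satisfy `α² + β² − 2cαβ ≥ (8/9)·R²`. -/
theorem two_system_rigidity (u v y : V) (hu : ‖u‖ = 1) (hv : ‖v‖ = 1) {c : ℝ} (hc : ⟪u, v⟫_ℝ = c)
    (hc2 : c ^ 2 = 1 / 9) {R : ℝ} (hR : 0 ≤ R)
    (hfar : ∀ z : V, ⟪u, z⟫_ℝ = 0 → ⟪v, z⟫_ℝ = 0 → R ≤ ‖y - z‖) :
    (8 / 9 : ℝ) * R ^ 2 ≤ ⟪u, y⟫_ℝ ^ 2 + ⟪v, y⟫_ℝ ^ 2 - 2 * c * ⟪u, y⟫_ℝ * ⟪v, y⟫_ℝ := by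
  have hc1 : c ^ 2 ≠ 1 := by rw [hc2]; norm_num
  have hle := hfar _ (inner_left_footPoint u v y hu hc hc1) (inner_right_footPoint u v y hv hc hc1)
  have hsq : R ^ 2 ≤ ‖y - footPoint u v y c‖ ^ 2 := pow_le_pow_left₀ hR hle 2
  have hid := norm_sub_footPoint_sq u v y hu hv hc hc1
  rw [hc2] at hid
  linarith

/-- The adversary's best case (acute wedge, `cos φ = 1/3`): with `a = |α|`, `b = |β|` the rigidity inequality reads
`a² + b² + (2/3)ab ≥ (8/9)R²`, i.e. `√(a² + b² + 2ab/3) ≥ (2√2/3)·R` (`= 75.4` at `R = 80`). -/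
theorem two_system_rigidity_abs (u v y : V) (hu : ‖u‖ = 1) (hv : ‖v‖ = 1) {c : ℝ} (hc : ⟪u, v⟫_ℝ = c)
    (hc2 : c ^ 2 = 1 / 9) {R : ℝ} (hR : 0 ≤ R)
    (hfar : ∀ z : V, ⟪u, z⟫_ℝ = 0 → ⟪v, z⟫_ℝ = 0 → R ≤ ‖y - z‖) :
    (8 / 9 : ℝ) * R ^ 2 ≤ |⟪u, y⟫_ℝ| ^ 2 + |⟪v, y⟫_ℝ| ^ 2 + (2 / 3) * |⟪u, y⟫_ℝ| * |⟪v, y⟫_ℝ| := by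
  have h := two_system_rigidity u v y hu hv hc hc2 hR hfar
  have hcabs : |c| = 1 / 3 := by
    have h9 : |c| ^ 2 = (1 / 3) ^ 2 := by rw [sq_abs, hc2]; norm_num
    exact (pow_left_inj₀ (abs_nonneg c) (by norm_num) two_ne_zero).1 h9
  have hprod : -(2 * c * ⟪u, y⟫_ℝ * ⟪v, y⟫_ℝ) ≤ (2 / 3) * |⟪u, y⟫_ℝ| * |⟪v, y⟫_ℝ| := by
    have habs : |2 * c * ⟪u, y⟫_ℝ * ⟪v, y⟫_ℝ| = (2 / 3) * |⟪u, y⟫_ℝ| * |⟪v, y⟫_ℝ| := by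
      rw [abs_mul, abs_mul, abs_mul, hcabs]
      norm_num
    exact habs ▸ neg_le_abs _
  rw [sq_abs, sq_abs]
  linarith

/-- RECORD NUMERICS at `R = ϱχ = 80` (g56 MEMO §2.2): not both offsets `≤ 46` (`(8/3)·46² = 5642.7 < 5688.9 = (8/9)·80²`;
the symmetric threshold is `80/√3 = 46.19`) … -/
theorem record_rigidity_not_both_le {a b : ℝ} (ha : 0 ≤ a) (hb : 0 ≤ b)
    (h : (8 / 9 : ℝ) * 80 ^ 2 ≤ a ^ 2 + b ^ 2 + (2 / 3) * a * b) : ¬ (a ≤ 46 ∧ b ≤ 46) := by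
  rintro ⟨ha', hb'⟩
  nlinarith [mul_le_mul ha' hb' hb (by norm_num : (0:ℝ) ≤ 46), mul_le_mul ha' ha' ha (by norm_num : (0:ℝ) ≤ 46),
    mul_le_mul hb' hb' hb (by norm_num : (0:ℝ) ≤ 46)]

/-- … and a site within `3` of one plane is `≥ 74` from the other (`9 + 74² + 2·74 = 5633 < 5688.9`). -/
theorem record_rigidity_far_of_near {a b : ℝ} (ha : 0 ≤ a) (hb : 0 ≤ b)
    (h : (8 / 9 : ℝ) * 80 ^ 2 ≤ a ^ 2 + b ^ 2 + (2 / 3) * a * b) (ha3 : a ≤ 3) : 74 ≤ b := by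
  by_contra hlt
  push Not at hlt
  nlinarith [mul_le_mul ha3 hlt.le hb (by norm_num : (0:ℝ) ≤ 3), mul_le_mul ha3 ha3 ha (by norm_num : (0:ℝ) ≤ 3),
    mul_self_lt_mul_self hb hlt]

/-- ★ WEDGE-CROSSING, algebraic core (g56 MEMO §2.3, typed). If two points lie on opposite sides of BOTH planes
(`α₁α₂ ≤ 0`, `β₁β₂ ≤ 0`) and each satisfies the rigidity inequality with radius `R`, then their DIFFERENCE satisfies it
with `(32/27)R²` in place of `(8/9)R²`.  Certificate: `F − (32/27)R² = (2/3)(T₁ − (8/9)R²) + (2/3)(T₂ − (8/9)R²) +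
(2/9)(Δα − 3cΔβ)² + (1/9)(Σα + 3cΣβ)² − (16/9)α₁α₂ − (16/9)β₁β₂`. -/
theorem wedge_crossing_form {c α₁ β₁ α₂ β₂ R : ℝ} (hc2 : c ^ 2 = 1 / 9)
    (h₁ : (8 / 9 : ℝ) * R ^ 2 ≤ α₁ ^ 2 + β₁ ^ 2 - 2 * c * α₁ * β₁)
    (h₂ : (8 / 9 : ℝ) * R ^ 2 ≤ α₂ ^ 2 + β₂ ^ 2 - 2 * c * α₂ * β₂)
    (hα : α₁ * α₂ ≤ 0) (hβ : β₁ * β₂ ≤ 0) :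
    (32 / 27 : ℝ) * R ^ 2 ≤ (α₁ - α₂) ^ 2 + (β₁ - β₂) ^ 2 - 2 * c * (α₁ - α₂) * (β₁ - β₂) := by
  have hc : c = 1 / 3 ∨ c = -(1 / 3) := by
    have h0 : (c - 1 / 3) * (c + 1 / 3) = 0 := by ring_nf; linarith
    rcases mul_eq_zero.1 h0 with h | h
    · exact Or.inl (by linarith)
    · exact Or.inr (by linarith)
  rcases hc with rfl | rfl
  · nlinarith [sq_nonneg (α₁ - α₂ - (β₁ - β₂)), sq_nonneg (α₁ + α₂ + (β₁ + β₂))]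
  · nlinarith [sq_nonneg (α₁ - α₂ + (β₁ - β₂)), sq_nonneg (α₁ + α₂ - (β₁ + β₂))]

/-- ★★ WEDGE-CROSSING (geometric). Two points on opposite sides of both planes of a `{111}`-dihedral pair, each at
distance `≥ R` from the junction line, are at distance `≥ (2/√3)·R` from each other: `‖y₁ − y₂‖² ≥ (4/3)R²`
(`= 92.38²` at `R = 80`; a segment shorter than that between two such points crosses only parallel planes). -/
theorem wedge_crossing (u v y₁ y₂ : V) (hu : ‖u‖ = 1) (hv : ‖v‖ = 1) {c : ℝ} (hc : ⟪u, v⟫_ℝ = c)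
    (hc2 : c ^ 2 = 1 / 9) {R : ℝ} (hR : 0 ≤ R)
    (h₁ : ∀ z : V, ⟪u, z⟫_ℝ = 0 → ⟪v, z⟫_ℝ = 0 → R ≤ ‖y₁ - z‖)
    (h₂ : ∀ z : V, ⟪u, z⟫_ℝ = 0 → ⟪v, z⟫_ℝ = 0 → R ≤ ‖y₂ - z‖)
    (hα : ⟪u, y₁⟫_ℝ * ⟪u, y₂⟫_ℝ ≤ 0) (hβ : ⟪v, y₁⟫_ℝ * ⟪v, y₂⟫_ℝ ≤ 0) :
    (4 / 3 : ℝ) * R ^ 2 ≤ ‖y₁ - y₂‖ ^ 2 := by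
  have hc1 : c ^ 2 ≠ 1 := by rw [hc2]; norm_num
  have t₁ := two_system_rigidity u v y₁ hu hv hc hc2 hR h₁
  have t₂ := two_system_rigidity u v y₂ hu hv hc hc2 hR h₂
  have hw := wedge_crossing_form hc2 t₁ t₂ hα hβ
  have hid := norm_sub_footPoint_sq u v (y₁ - y₂) hu hv hc hc1
  have hle := norm_sub_footPoint_le u v (y₁ - y₂) hu hv hc hc1
  rw [inner_sub_right, inner_sub_right, hc2] at hid
  nlinarith [hid, hle, hw]

/-- RECORD NUMERIC at `R = ϱχ = 80`: wedge-crossing points are `≥ 92` apart (`92² = 8464 ≤ 8533.3 = (4/3)·80²`), the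
`92 = ϱχ + 12` of g56 `record_proximity`. -/
theorem record_wedge_crossing_92 {d : ℝ} (hd : 0 ≤ d) (h : (4 / 3 : ℝ) * 80 ^ 2 ≤ d ^ 2) : 92 ≤ d := by
  nlinarith

end Rigidity

end Summit.AtomisticToContinuum.Crystallization.Theorems.ChargedEnergyGapChartDial
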